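import Summits.BirchSwinnertonDyer.BirchSwinnertonDyer.Theorems.ByReductionTypeAtTwoMultTransportP49KernelLEO
import Summits.BirchSwinnertonDyer.BirchSwinnertonDyer.Theorems.ByReductionTypeAtTwoMultTransportP49KernelNoPT
import HarnessLib

/-!
# T-42-mult in the kernel, LVIII — P49-KERNEL (16): LEO(`E[p^∞] ⊗ Λ^*`) over `ℚ` and GREENBERG'S PROP. 4.9 FROM
# FOUR NAMED FACTS — Harari Thm. 17.13 (a) is no longer an input (Greenberg 2006 Prop. 3.2 is a tree theorem)

Cell `bsd-2adic` (run/shared/lean/pub/bsd-2adic/), seat `bsd-2adic-t42` GEN 26 (memo `t42/DESIGN-T42-ADDENDUM-29` §A29.4,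
audit-2's hTateEPC ADDENDUM-1 recipe). HONEST FRAMING: research route; THEOREMS ONLY (no `def`, no named fact, no
instance, no `sorry`; no new mathematics — file LVI's carrying theorems re-landed with ONE term swapped); nothing
booked; BSD is not proved by any of this. PARTITION: X5@2 multiplicative GV-transport rows (K4ᵐ B1·O1; the PRINT binder
P49 = `Greenberg1999.prop49_noFiniteSubmodule_H1Sigma` of `multCongruenceTransportAtTwo_of_print49`, p663002) × all p —
reduces-the-named-input-of; bears_on K4 19922 / 19923 (`--supports stmt-BirchSwinnertonDyer-19923`).

## What

File LVI (`…P49KernelLEO`, GEN 19) proved Greenberg's Prop. 4.9 over `ℚ` from FIVE named facts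
{Greenberg 2006 Prop. 5.2, Prop. 6.3, Thm. 1 (i); Harari Thm. 17.13 (b), (a)}. Harari 17.13 (a)
(`hPTa : poitouTate_restricted_three_le ℚ`) entered at exactly one place — the squeeze step's «`H²(G_S, 𝒜_S)` is
cofinitely generated» = Greenberg 2006 Prop. 3.2, obtained as `prop32_of_poitouTate_at hPTb hPTa`. Prop. 3.2 is now the
tree theorem `Greenberg2006.prop32_at` (⟸ NSW (8.3.20) = `GaloisCohomology.finite_restrictedCohomology_holds`, every
number field, cell `bsd-eis`). Hence:

* `exists_ne_zero_forall_smul_H_two_bigRep_eq_zero_noPTa`, `leo_bigRep_of_isTorsion_noPTa` — LEO(`𝒜_S`) from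
  `X(E/ℚ_∞)` torsion GRANTED Harari 17.13 (b) alone (the Ш-duality at the finite modules `E[p^k](χ_u)` is a genuine
  use of Poitou–Tate and stays displayed);
* **`prop49_noFiniteSubmodule_H1Sigma_of_four_facts`** —
  `prop52_localH2_torsionBy_injective → prop63_shaAway_smul_surjective → thm1_sha2_isCoreflexive →
   poitouTate_shaRestricted_tateDual ℚ → prop49_noFiniteSubmodule_H1Sigma` (file LVII's `prop49_of_LEO_noPT` with (I1)
  supplied here). Trust base of P49: PRINT⁴ {Greenberg 2006 Prop. 5.2, Prop. 6.3, Thm. 1 (i); Harari Thm. 17.13 (b)}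
  + kernel (was PRINT⁵).

References: [GreenbergLNM1716] Prop. 4.9 and its proof pp. 112–118; [Greenberg2006] Thm. 1, Props. 3.2, 5.2, 6.3;
[Greenberg2016Selmer] Prop. 2.6.1; [Harari2020] Thm. 17.13 (b), Cor. 17.17; [NeukirchSchmidtWingberg2008] (8.3.20).
-/

set_option autoImplicit false
set_option linter.dupNamespace false

noncomputable section

open scoped Classical

namespace Summit.BirchSwinnertonDyer.BirchSwinnertonDyer.Theorems.P49Kernel

open NumberField IsDedekindDomain Field WeierstrassCurve
  Literature.NumberTheory.EllipticCurves Literature.NumberTheory.EllipticCurves.BigRepModule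
  Literature.NumberTheory.EllipticCurves.BigGaloisRep
  Literature.NumberTheory.EllipticCurves.Greenberg1999
  Literature.NumberTheory.GaloisRepresentations Literature.NumberTheory.GaloisCohomology
  Literature.NumberTheory.IwasawaTheory.Greenberg2006 Literature.NumberTheory.IwasawaTheory.Greenberg2016

variable {p : ℕ} [Fact p.Prime]

/-- **A non-zero annihilator of `H²(G_{ℚ,S}, 𝒜_S)`** (`𝒜_S = E[p^∞] ⊗ Λ^*(κ̄⁻¹)` the co-induced module of
`prop49_of_LEO_noPT`) when `X(E/ℚ_∞)` is a torsion `Λ`-module — Greenberg's «`H²(F_Σ/F_∞, E[p^∞])` has `Λ`-corank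
`0`» (LNM 1716 p. 114), over `ℚ` for every `p`, by the twist/exponent route of files L–LV, GRANTED Harari
Thm. 17.13 (b) ONLY (the Ш-duality `p^a · Ш¹_S(E[p^k](χ_u)^D) = 0 ⇒ p^a · Ш²_S(E[p^k](χ_u)) = 0`). = file LVI's
`exists_ne_zero_forall_smul_H_two_bigRep_eq_zero` with the cofinite generation of `H²(G_S, 𝒜_S)` (Greenberg 2006
Prop. 3.2) supplied by the tree theorem `Greenberg2006.prop32_at` instead of `prop32_of_poitouTate_at hPTb hPTa`.
[cite: GreenbergLNM1716, §4 pp. 114–118] [cite: Greenberg2006, Prop. 3.2] [cite: Harari2020, Thm. 17.13 (b)]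
[cite: NeukirchSchmidtWingberg2008, (8.3.20)] -/
theorem exists_ne_zero_forall_smul_H_two_bigRep_eq_zero_noPTa
    (hPTb : poitouTate_shaRestricted_tateDual ℚ)
    (W : WeierstrassCurve ℚ) [W.IsElliptic] (κ : ZpExtension ℚ p) {γ : absoluteGaloisGroup ℚ}
    (hκ : κ.IsCyclotomic) (hγ : κ.IsTopGenerator γ) (S₀ : Finset (HeightOneSpectrum (𝓞 ℚ)))
    (hbad : ∀ v : HeightOneSpectrum (𝓞 ℚ), v ∉ S₀ → ((p : ℕ) : 𝓞 ℚ) ∉ v.asIdeal → W.HasGoodReductionAt v)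
    (D : W.SelmerDualData κ γ) (hD : D.IsTorsion)
    [TopologicalSpace (IwasawaAlgebra p)] [DiscreteTopology (IwasawaAlgebra p)] [IsTopologicalRing (IwasawaAlgebra p)]
    (ρ₀ : ContinuousRep (GaloisGroupUnramifiedOutside ℚ
        ((↑S₀ : Set (HeightOneSpectrum (𝓞 ℚ))) ∪ {v : HeightOneSpectrum (𝓞 ℚ) | ((p : ℕ) : 𝓞 ℚ) ∈ v.asIdeal}))
      ℤ_[p] (PrimaryTorsion W.geomPoints p))
    (hρ₀ : ∀ (σ : absoluteGaloisGroup ℚ) (P : PrimaryTorsion W.geomPoints p),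
      ρ₀ (toUnramifiedQuot ℚ _ σ) P = σ • P) :
    ∃ r : IwasawaAlgebra p, r ≠ 0 ∧
      ∀ c : (bigRep (κ.liftUnramifiedOutside _ (mem_union_setOf_natCast_mem p S₀)) ρ₀).H 2, r • c = 0 := by
  -- the arena `S = S₀ ∪ {p}`
  have hS : ((↑S₀ : Set (HeightOneSpectrum (𝓞 ℚ))) ∪
      {v : HeightOneSpectrum (𝓞 ℚ) | ((p : ℕ) : 𝓞 ℚ) ∈ v.asIdeal}).Finite :=
    finite_union_setOf_natCast_mem p (Fact.out : p.Prime).ne_zero S₀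
  have hSp := mem_union_setOf_natCast_mem (K := ℚ) p S₀
  -- the exceptional sets: global (LIV) and local (LV), and a twist `u` avoiding them
  obtain ⟨E₁, hE₁fin, hE₁⟩ := exists_pow_smul_shaRestricted_tateDual_eq_zero_rat W p κ S₀ hκ hγ D hD
  choose Ev hEvfin hEv using fun v : HeightOneSpectrum (𝓞 ℚ) ↦
    exists_pow_smul_galoisCohomology_two_twisted_eq_zero W p κ v hκ
  have hEfin : (E₁ ∪ ⋃ v ∈ ((↑S₀ : Set (HeightOneSpectrum (𝓞 ℚ))) ∪
      {v : HeightOneSpectrum (𝓞 ℚ) | ((p : ℕ) : 𝓞 ℚ) ∈ v.asIdeal}), Ev v).Finite :=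
    hE₁fin.union (hS.biUnion fun v _ ↦ hEvfin v)
  -- the integers `u ≡ 1 (mod p)` form an infinite set (tree: `PrintCf2.RestrictedSelmerPair.infinite_setOf_dvd_sub_one`)
  have hinf : {u : ℤ | (p : ℤ) ∣ u - 1}.Infinite :=
    Set.infinite_of_injective_forall_mem (f := fun n : ℕ ↦ 1 + (p : ℤ) * n)
      (fun a b h ↦ by
        have hp : (p : ℤ) ≠ 0 := by exact_mod_cast (Fact.out : p.Prime).ne_zero
        have := mul_left_cancel₀ hp (add_left_cancel h)
        exact_mod_cast this)
      fun n ↦ ⟨n, by ring⟩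
  obtain ⟨u, ⟨hu, huE⟩⟩ := (hinf.sdiff hEfin).nonempty
  have hu : (p : ℤ) ∣ u - 1 := hu
  have huE₁ : u ∉ E₁ := fun h ↦ huE (Or.inl h)
  have huEv : ∀ v ∈ ((↑S₀ : Set (HeightOneSpectrum (𝓞 ℚ))) ∪
      {v : HeightOneSpectrum (𝓞 ℚ) | ((p : ℕ) : 𝓞 ℚ) ∈ v.asIdeal}), u ∉ Ev v :=
    fun v hv h ↦ huE (Or.inr (Set.mem_biUnion hv h))
  obtain ⟨a, ha⟩ := hE₁ u hu huE₁
  have hloc : ∀ v ∈ ((↑S₀ : Set (HeightOneSpectrum (𝓞 ℚ))) ∪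
      {v : HeightOneSpectrum (𝓞 ℚ) | ((p : ℕ) : 𝓞 ℚ) ∈ v.asIdeal}),
      ∃ f : ℕ, ∀ (k : ℕ) [Finite (W.geomTorsion ((p ^ k : ℕ) : ℤ))], 0 < k →
      ∀ z : galoisCohomology ((W.twistedTorsionGaloisModule p κ k u hu).toLocal (Sum.inr v)) 2,
        p ^ (2 * f) • z = 0 := fun v hv ↦ hEv v u hu (huEv v hv)
  choose! fv hfv using hloc
  set fmax : ℕ := hS.toFinset.sup fv with hfmax
  set n : ℕ := p ^ a * (2 * p ^ (2 * fmax)) with hndef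
  have hn0 : n ≠ 0 := by
    have hp : p ≠ 0 := (Fact.out : p.Prime).ne_zero
    positivity
  -- finite level: `n` kills `H²(G_S, E[p^k](χ_u))` for every `k ≥ 1`
  have hfinite : ∀ (k : ℕ), 0 < k →
      ∀ x : (W.twistedTorsionGaloisModule p κ k u hu).restrictedCohomology
        ((↑S₀ : Set (HeightOneSpectrum (𝓞 ℚ))) ∪ {v : HeightOneSpectrum (𝓞 ℚ) | ((p : ℕ) : 𝓞 ℚ) ∈ v.asIdeal}) 2,
        n • x = 0 := by
    intro k hk
    haveI : NeZero (p ^ k) := ⟨pow_ne_zero _ (Fact.out : p.Prime).ne_zero⟩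
    haveI : Finite (W.geomTorsion ((p ^ k : ℕ) : ℤ)) := finite_geomTorsion_of_neZero W (p ^ k)
    -- `E[p^k](χ_u)` is a `G_S`-module of order `p^{2k}`
    have hur : GaloisRep.IsUnramifiedOutside
        ((↑S₀ : Set (HeightOneSpectrum (𝓞 ℚ))) ∪ {v : HeightOneSpectrum (𝓞 ℚ) | ((p : ℕ) : 𝓞 ℚ) ∈ v.asIdeal})
        (W.twistedTorsionGaloisModule p κ k u hu) := fun v hv ↦
      W.isUnramifiedAt_twistedTorsionGaloisModule p κ k u hu (hbad v (fun h ↦ hv (Or.inl h)) (fun h ↦ hv (Or.inr h)))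
        (fun h ↦ hv (Or.inr h))
    have hcardM : Nat.card (W.geomTorsion ((p ^ k : ℕ) : ℤ)) = (p ^ k) ^ 2 :=
      card_torsionPoints_eq_sq_holds W (AlgebraicClosure ℚ)
        (by exact_mod_cast pow_ne_zero k (Fact.out : p.Prime).ne_zero)
    have hcard : ∀ v : HeightOneSpectrum (𝓞 ℚ),
        ((Nat.card (W.geomTorsion ((p ^ k : ℕ) : ℤ)) : ℕ) : 𝓞 ℚ) ∈ v.asIdeal →
          v ∈ ((↑S₀ : Set (HeightOneSpectrum (𝓞 ℚ))) ∪
            {v : HeightOneSpectrum (𝓞 ℚ) | ((p : ℕ) : 𝓞 ℚ) ∈ v.asIdeal}) := fun v hv ↦ by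
      rw [hcardM, ← pow_mul, Nat.cast_pow] at hv
      exact hSp v (v.isPrime.mem_of_pow_mem _ hv)
    -- Poitou–Tate (b): `p^a` kills `Ш²_S`
    obtain ⟨-, -, b, hb, -⟩ := hPTb _ (p ^ k) (W.geomTorsion ((p ^ k : ℕ) : ℤ))
      (W.twistedTorsionGaloisModule p κ k u hu) (W.pow_nsmul_geomTorsion_pow p k) hur hcard
    have hsha : ∀ x : (W.twistedTorsionGaloisModule p κ k u hu).shaRestricted
        ((↑S₀ : Set (HeightOneSpectrum (𝓞 ℚ))) ∪ {v : HeightOneSpectrum (𝓞 ℚ) | ((p : ℕ) : 𝓞 ℚ) ∈ v.asIdeal}) 2,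
        p ^ a • x = 0 :=
      nsmul_shaRestricted_two_eq_zero_of_pairing _ _ (p ^ k) b hb.1 (ha k hk)
    -- the local exponents
    have hfin' : ∀ v ∈ ((↑S₀ : Set (HeightOneSpectrum (𝓞 ℚ))) ∪
        {v : HeightOneSpectrum (𝓞 ℚ) | ((p : ℕ) : 𝓞 ℚ) ∈ v.asIdeal}),
        ∀ y : galoisCohomology ((W.twistedTorsionGaloisModule p κ k u hu).toLocal (Sum.inr v)) 2,
          (2 * p ^ (2 * fmax)) • y = 0 := by
      intro v hv y
      have hle : fv v ≤ fmax := Finset.le_sup (hS.mem_toFinset.mpr hv)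
      refine nsmul_eq_zero_of_dvd_of_nsmul_eq_zero ?_ (hfv v hv k hk y)
      exact Dvd.dvd.mul_left (pow_dvd_pow p (by omega)) 2
    have hinf' : ∀ (w : InfinitePlace ℚ)
        (y : galoisCohomology ((W.twistedTorsionGaloisModule p κ k u hu).toLocal (Sum.inl w)) 2),
        (2 * p ^ (2 * fmax)) • y = 0 := fun w y ↦
      nsmul_eq_zero_of_dvd_of_nsmul_eq_zero (dvd_mul_right 2 _) (two_nsmul_galoisCohomology_two_infinitePlace w _ y)
    exact nsmul_restrictedCohomology_two_eq_zero _ _ hsha hfin' hinf'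
  -- transport to the twist pieces `𝒜[θ_u][p^k]` (LIII), all `k`
  have hpieces : ∀ (k : ℕ) (y : (((bigRep (κ.liftUnramifiedOutside _ hSp) ρ₀).subrepresentation
      (Submodule.torsionBy (IwasawaAlgebra p) (BigRepModule ℤ_[p] p (PrimaryTorsion W.geomPoints p))
        (PowerSeries.C ((u : ℤ_[p])) * PowerSeries.X + PowerSeries.C ((u : ℤ_[p]) - 1) : IwasawaAlgebra p))
      ((bigRep (κ.liftUnramifiedOutside _ hSp) ρ₀).torsionBy_smul_le_comap
        (PowerSeries.C ((u : ℤ_[p])) * PowerSeries.X + PowerSeries.C ((u : ℤ_[p]) - 1) : IwasawaAlgebra p))).subrepresentation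
        (Submodule.torsionBy (IwasawaAlgebra p)
          (Submodule.torsionBy (IwasawaAlgebra p) (BigRepModule ℤ_[p] p (PrimaryTorsion W.geomPoints p))
        (PowerSeries.C ((u : ℤ_[p])) * PowerSeries.X + PowerSeries.C ((u : ℤ_[p]) - 1) : IwasawaAlgebra p))
          ((p : IwasawaAlgebra p) ^ k))
        (((bigRep (κ.liftUnramifiedOutside _ hSp) ρ₀).subrepresentation
          (Submodule.torsionBy (IwasawaAlgebra p) (BigRepModule ℤ_[p] p (PrimaryTorsion W.geomPoints p))
        (PowerSeries.C ((u : ℤ_[p])) * PowerSeries.X + PowerSeries.C ((u : ℤ_[p]) - 1) : IwasawaAlgebra p))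
          ((bigRep (κ.liftUnramifiedOutside _ hSp) ρ₀).torsionBy_smul_le_comap
        (PowerSeries.C ((u : ℤ_[p])) * PowerSeries.X + PowerSeries.C ((u : ℤ_[p]) - 1) : IwasawaAlgebra p))).torsionBy_smul_le_comap
          ((p : IwasawaAlgebra p) ^ k))).H 2), n • y = 0 := by
    intro k
    rcases Nat.eq_zero_or_pos k with rfl | hk
    · -- `k = 0`: the piece is the zero module
      exact fun y ↦ nsmul_H_torsionBy_pow_zero_eq_zero _ (p : IwasawaAlgebra p) 2 n y
    · obtain ⟨η, hη⟩ := exists_continuousAddEquiv_twistPiece W κ ρ₀ k hSp hρ₀ hu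
      exact nsmul_H_eq_zero_of_continuousAddEquiv _
        ((W.twistedTorsionGaloisModule p κ k u hu).quotientInvariants (ramificationSubgroup ℚ _)) η hη 2
        (fun y ↦ hfinite k hk y)
  -- `n` kills `H²(G_S, 𝒜)[θ_u]` (LI), and the squeeze (L) with Prop. 3.2
  have hkill : ∀ x : (bigRep (κ.liftUnramifiedOutside _ hSp) ρ₀).H 2,
      (PowerSeries.C ((u : ℤ_[p])) * PowerSeries.X + PowerSeries.C ((u : ℤ_[p]) - 1) : IwasawaAlgebra p) • x = 0 → n • x = 0 :=
    nsmul_torsionBy_H_eq_zero_of_forall_pow _ _ (twist_smul_surjective p W hu) p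
      (fun d ↦ exists_pow_smul_eq_zero_twistTorsion p W d) (pow_smul_surjective_twistTorsion p W hu) 2 hpieces
  obtain ⟨e⟩ := nonempty_ringEquiv_mvPowerSeries_fin_one p
  have hcof : IsCofinitelyGenerated (IwasawaAlgebra p) ((bigRep (κ.liftUnramifiedOutside _ hSp) ρ₀).H 2) :=
    (prop32_at _ hS hSp e _ (isCofinitelyGenerated_bigRepModule p W)).1 2
  exact exists_ne_zero_forall_smul_eq_zero_of_nsmul_torsionBy hcof hu hn0 hkill

/-- **LEO(`𝒜_S`) over `ℚ` from `X(E/ℚ_∞)` torsion, GRANTED Harari Thm. 17.13 (b) alone** — the input (I1) of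
`prop49_of_LEO_noPT` VERBATIM: `Ш²(ℚ, Σ, E[p^∞] ⊗ Λ^*(κ̄⁻¹))` is `Λ`-cotorsion (`Greenberg2016.LEO`).
[cite: GreenbergLNM1716, §4 pp. 114–118] [cite: Greenberg2016Selmer, §2.2 p. 6 (LEO)] [cite: Harari2020, Thm. 17.13 (b)] -/
theorem leo_bigRep_of_isTorsion_noPTa
    (hPTb : poitouTate_shaRestricted_tateDual ℚ)
    (W : WeierstrassCurve ℚ) [W.IsElliptic] (κ : ZpExtension ℚ p) {γ : absoluteGaloisGroup ℚ}
    (hκ : κ.IsCyclotomic) (hγ : κ.IsTopGenerator γ) (S₀ : Finset (HeightOneSpectrum (𝓞 ℚ)))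
    (hbad : ∀ v : HeightOneSpectrum (𝓞 ℚ), v ∉ S₀ → ((p : ℕ) : 𝓞 ℚ) ∉ v.asIdeal → W.HasGoodReductionAt v)
    (D : W.SelmerDualData κ γ) (hD : D.IsTorsion)
    [TopologicalSpace (IwasawaAlgebra p)] [DiscreteTopology (IwasawaAlgebra p)] [IsTopologicalRing (IwasawaAlgebra p)]
    (ρ₀ : ContinuousRep (GaloisGroupUnramifiedOutside ℚ
        ((↑S₀ : Set (HeightOneSpectrum (𝓞 ℚ))) ∪ {v : HeightOneSpectrum (𝓞 ℚ) | ((p : ℕ) : 𝓞 ℚ) ∈ v.asIdeal}))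
      ℤ_[p] (PrimaryTorsion W.geomPoints p))
    (hρ₀ : ∀ (σ : absoluteGaloisGroup ℚ) (P : PrimaryTorsion W.geomPoints p),
      ρ₀ (toUnramifiedQuot ℚ _ σ) P = σ • P) :
    LEO ((↑S₀ : Set (HeightOneSpectrum (𝓞 ℚ))) ∪ {v : HeightOneSpectrum (𝓞 ℚ) | ((p : ℕ) : 𝓞 ℚ) ∈ v.asIdeal})
      (bigRep (κ.liftUnramifiedOutside _ (mem_union_setOf_natCast_mem p S₀)) ρ₀) :=
  leo_of_exists_ne_zero_forall_smul_eq_zero _ _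
    (exists_ne_zero_forall_smul_H_two_bigRep_eq_zero_noPTa hPTb W κ hκ hγ S₀ hbad D hD ρ₀ hρ₀)

/-- **GREENBERG'S PROPOSITION 4.9 OVER `ℚ` (all `p`) FROM FOUR NAMED FACTS**: `H¹(ℚ_Σ/ℚ_∞, E[p^∞])` has no proper
`Λ`-submodule of finite index whenever `Sel_E(ℚ_∞)_p` is `Λ`-cotorsion — `Greenberg1999.prop49_noFiniteSubmodule_H1Sigma`
— granted Greenberg 2006 Prop. 5.2 / Prop. 6.3 / Thm. 1 (i) and Harari Thm. 17.13 (b) for `ℚ`; every other input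
(Greenberg 2006 Prop. 3.2 = `Greenberg2006.prop32_at`, (I1) LEO here, (I2)–(I4) files XLIV–XLVIII) is kernel. = file
LVI's `prop49_noFiniteSubmodule_H1Sigma_of_facts` minus the binder `hPTa` (Harari Thm. 17.13 (a)).
[cite: GreenbergLNM1716, Prop. 4.9 and its proof pp. 112–118] [cite: Greenberg2006, Thm. 1, Props. 3.2, 5.2, 6.3]
[cite: Harari2020, Thm. 17.13 (b)] [cite: NeukirchSchmidtWingberg2008, (8.3.20)] -/
theorem prop49_noFiniteSubmodule_H1Sigma_of_four_facts
    (h52 : prop52_localH2_torsionBy_injective) (h63 : prop63_shaAway_smul_surjective)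
    (hT1 : thm1_sha2_isCoreflexive) (hPTb : poitouTate_shaRestricted_tateDual ℚ) :
    prop49_noFiniteSubmodule_H1Sigma :=
  prop49_of_LEO_noPT h52 h63 hT1 fun W _ _ p _ κ γ hκ hγ S₀ hbad D hD ↦ by
    letI : TopologicalSpace (IwasawaAlgebra p) := ⊥
    intro _ _ ρ₀ hρ₀
    exact leo_bigRep_of_isTorsion_noPTa hPTb W κ hκ hγ S₀ hbad D hD ρ₀ hρ₀

end Summit.BirchSwinnertonDyer.BirchSwinnertonDyer.Theorems.P49Kernel

end
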